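import Literature.NumberTheory.Transcendental.DiazThm1Unconditional
import Literature.NumberTheory.Transcendental.DiazZeroLemmaHolds
import Literature.NumberTheory.Transcendental.PhilipponCriterionMain
import Literature.NumberTheory.Transcendental.NesterenkoEliminationCor412Proofs
import Literature.NumberTheory.Transcendental.NesterenkoEliminationProp44Holds
import Literature.NumberTheory.Transcendental.NesterenkoEliminationProp413Proofs
import HarnessLib

/-!
# Diaz's `d × ℓ` grid, clause `t₁ ≥ [d(ℓ+1)/(ℓ+d)]` (`Diaz1989_gridX`): the range
# `[d(ℓ+1)/(ℓ+d)] ≤ 2`, proved, and what is left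

Topic `Literature/NumberTheory/Transcendental`. Proof companion of `DiazGrid.lean` for the named
fact `Literature.NumberTheory.Transcendental.Diaz1989_gridX` (Yu. V. Nesterenko, P. Philippon
(eds.), LNM 1752, Ch. 14 (M. Waldschmidt), Theorem 2.7, second conclusion with the Remark, PDF
p. 248, quoted there as "the main result of G. Diaz in [Dia2]" = Diaz 1989, Théorème 1): for
`ℚ`-linearly independent `x₁, …, x_d` and `y₁, …, y_ℓ` satisfying the Technical Hypothesis
(T.H.), `dℓ > ℓ + d`, and any subfield `K ⊆ ℂ` containing the `dℓ` numbers `e^{xᵢyⱼ}`,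
`t₁ = trdeg_ℚ K(x₁, …, x_d) ≥ [d(ℓ+1)/(ℓ+d)]`.

A sibling file is needed because `DiazGrid.lean` sits below `DiazMain.lean`,
`DiazThm1Unconditional.lean`, `DiazZeroLemmaHolds.lean` and `PhilipponCriterionMain.lean` in the
import order (the file name
`DiazGridProofs.lean` is the companion of the first conclusion, `Diaz1989_grid`).

Everything here is PROVED; no definition and no named fact is introduced.

* `DiazGridX.one_le_natDiv`, `DiazGridX.natDiv_le_two_iff`, `DiazGridX.three_le_natDiv`,
  `DiazGridX.lt_three_mul_of_le` — arithmetic of the printed bound: under the standing hypothesis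
  `dℓ > ℓ + d` one has `[d(ℓ+1)/(ℓ+d)] ≥ 1`; `[d(ℓ+1)/(ℓ+d)] ≤ 2` exactly in the range
  `d(ℓ+1) < 3(ℓ+d)`, which contains every pair with `d ≤ 3` or `ℓ ≤ 2` (and also
  `(4, 3), …, (4, 7)`, `(5, 3), (5, 4)`, `(6, 3), (7, 3), (8, 3)`); in the complementary range
  `d ≥ 4` and `ℓ ≥ 3`.
* `Diaz1989_gridX.trdeg_adjoin_le` — any `K ∋ e^{xᵢyⱼ}` has `K(x) ⊇ ℚ(xᵢ, e^{xᵢyⱼ})`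
  (`= K₃` of Ch. 13 Thm 3.1 = Diaz's `ℚ(v_k, e^{u_hv_k})` with `v = x`, `u = y`), so it suffices
  to bound the transcendence degree of the generated field (monotonicity of `trdeg`).
* `Diaz1989_gridX.one_le_trdeg` — **`t₁ ≥ 1` whenever `dℓ > ℓ + d`**, for `ℚ`-linearly
  independent `x`, `y` and ANY `K ∋ e^{xᵢyⱼ}`, with no Technical Hypothesis: the Gelfond–Schneider
  theorem (`DiazMain.one_le_trdeg_adjoin`, `DiazMainIIProofs.lean`, from the tree's PROVED
  `gelfond_schneider_holds`).
* `Diaz1989_gridX.two_le_trdeg` — **`t₁ ≥ 2` whenever `dℓ ≥ d + 2ℓ`**, again with no (T.H.): this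
  is LNM 1752, Ch. 14, Theorem 2.9, clause `t₁` (PDF p. 249) = Ch. 13, Theorem 3.1 (iii)
  (`mn ≥ m + 2n ⇒ trdeg ℚ(xᵢ, e^{xᵢyⱼ}) ≥ 2`, PDF p. 233; Gel'fond–Tijdeman), which the tree
  PROVES (`Laurent2001_thm_3_1_iii_holds`, `ExpSmallTrdegProofs.lean`), transported from
  `ℚ(xᵢ, e^{xᵢyⱼ})` to `K(x)`.
* `Diaz1989_gridX_midRange` — hence **the conclusion of `Diaz1989_gridX` HOLDS outright in the
  range `d(ℓ+1) < 3(ℓ+d)`** (there `[d(ℓ+1)/(ℓ+d)] ≤ 2`, and the value `2` is taken exactly when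
  `2(ℓ+d) ≤ d(ℓ+1)`, i.e. `dℓ ≥ d + 2ℓ`), for all `ℚ`-linearly independent families and without
  (T.H.) — through the tree's `Diaz1989_thm1_midRange` (`DiazThm1Unconditional.lean`; Laurent 1991,
  Remarque 3: no measure of linear independence is needed in transcendence degree `≤ 2`);
  `Diaz1989_gridX_of_d_le_three_or_l_le_two` — in particular whenever `d ≤ 3` or `ℓ ≤ 2`.
* `Diaz1989_gridX_of_largeRange`, `Diaz1989_gridX_iff_largeRange` — reduction of the fact: it
  suffices to prove it in the complementary range `3(ℓ+d) ≤ d(ℓ+1)` (`[d(ℓ+1)/(ℓ+d)] ≥ 3`, so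
  `d ≥ 4`, `ℓ ≥ 3`), where large transcendence degree is asserted and Diaz's method is needed;
  `Diaz1989_gridX_of_thm1_largeRange` — equivalently, from Diaz's Théorème 1 restricted to its
  own large range `3(m+n) ≤ mn + m`.

* `Diaz1989_gridX_of_nesterenko` — the whole fact from the three core named facts of LNM 1752
  Ch. 3 §4 (Prop. 4.4: the associated form; Prop. 4.11: the Bézout inequality; Prop. 4.13: a
  close zero), i.e. its current trust base: `Diaz1989_gridX_of_mainCriterion`
  (`DiazZeroLemmaHolds.lean`: Diaz's method with Philippon's zero estimate
  `Philippon1986_GaGm_P1n_holds` / Diaz's zero lemma `Diaz1989_zeroLemma_holds` PROVED) fed with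
  `Philippon1986_mainCriterion_of_nesterenko'` (`PhilipponCriterionMain.lean`: Philippon's
  criterion derived from Ch. 3 §4, Cor. 4.10 discharged), Prop. 4.7 ⇐ Prop. 4.4
  (`NesterenkoPhilippon2001_ch3_prop_4_7_of_prop_4_4`,
  `NesterenkoEliminationProp47ValuesProofs.lean`) and Cor. 4.12 ⇐ Prop. 4.11
  (`NesterenkoPhilippon2001_ch3_cor_4_12_of_prop_4_11`, `NesterenkoEliminationCor412Proofs.lean`).
* `Diaz1989_gridX_of_prop_4_11 : NesterenkoPhilippon2001_ch3_prop_4_11 → Diaz1989_gridX` — now that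
  Prop. 4.4 is a theorem of the tree (`NesterenkoPhilippon2001_ch3_prop_4_4_holds`,
  `NesterenkoEliminationProp44Holds.lean`) and Prop. 4.13 ⇐ Prop. 4.4 is proved
  (`NesterenkoPhilippon2001_ch3_prop_4_13_of_prop_4_4`, `NesterenkoEliminationProp413Proofs.lean`),
  the single remaining leaf under Thm 2.7 (t₁) is Nesterenko's Bézout inequality, Prop. 4.11.

What is NOT here: the discharge `Diaz1989_gridX_holds`. In the range `3(ℓ+d) ≤ d(ℓ+1)` the only
printed proof (Diaz 1989, §II: a Schneider-type auxiliary function with coefficients in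
`ℤ[e^{xᵢyⱼ}]`, Philippon's zero estimate on `𝔾ₐ × 𝔾ₘⁿ`, Philippon's criterion for algebraic
independence) is carried out in the tree CONDITIONALLY on the criterion
(`Diaz1989_gridX_of_mainCriterion : Philippon1986_mainCriterion → Diaz1989_gridX`,
`DiazZeroLemmaHolds.lean`), and the criterion is reduced to the three named facts above, of which
Prop. 4.11 is not yet discharged. The discharge `Diaz1989_gridX_holds` is
`Diaz1989_gridX_of_prop_4_11` applied to the discharge of Prop. 4.11, once it lands (append to
this file).

## References

* Yu. V. Nesterenko, P. Philippon (eds.), *Introduction to Algebraic Independence Theory*,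
  LNM 1752, Springer 2001: Ch. 13 (M. Laurent), Theorem 3.1 (iii), PDF p. 233; Ch. 14
  (M. Waldschmidt), Theorem 2.7 and Remark (PDF p. 248), Theorem 2.9 (PDF p. 249).
  [NesterenkoPhilippon2001]
* G. Diaz, *Grands degrés de transcendance pour des familles d'exponentielles*, J. Number Theory
  31 (1989), 1–23, Théorème 1 (pp. 1–2) (as quoted in LNM 1752, Ch. 14, Theorem 2.7).
  [Diaz1989]
* M. Laurent, *Sur quelques résultats récents de transcendance*, Astérisque 198–200 (1991),
  209–230, §3.1, p. 212, Théorème 3 ii) (p. 213) and Remarque 3 (p. 214). [Laurent1991]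
-/

noncomputable section

open IntermediateField Complex

namespace Literature.NumberTheory.Transcendental

open Nesterenko
open Literature.Barriers.Schanuel (gridField₁)

/-! ### Arithmetic of the bound `[d(ℓ+1)/(ℓ+d)]` -/

/-- Under the standing hypothesis `ℓ + d < dℓ` of Theorem 2.7 the printed bound for `t₁` is at
least `1`: `[d(ℓ+1)/(ℓ+d)] ≥ 1`. [folklore] -/
theorem DiazGridX.one_le_natDiv {d l : ℕ} (h : l + d < d * l) : 1 ≤ d * (l + 1) / (l + d) := by
  have hpos : 0 < l + d := by
    have := (two_le_of_add_lt_mul h).2.1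
    omega
  have e : d * (l + 1) = d * l + d := by ring
  exact (Nat.one_le_div_iff hpos).mpr (by omega)

/-- For `ℓ + d > 0`: `[d(ℓ+1)/(ℓ+d)] ≤ 2 ↔ d(ℓ+1) < 3(ℓ+d)`. [folklore] -/
theorem DiazGridX.natDiv_le_two_iff {d l : ℕ} (hpos : 0 < l + d) :
    d * (l + 1) / (l + d) ≤ 2 ↔ d * (l + 1) < 3 * (l + d) := by
  rw [← Nat.lt_succ_iff, Nat.div_lt_iff_lt_mul hpos]

/-- For `ℓ + d > 0`: `2 ≤ [d(ℓ+1)/(ℓ+d)] ↔ dℓ ≥ d + 2ℓ` — the hypothesis of LNM 1752, Ch. 14,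
Theorem 2.9, clause `t₁` (= Ch. 13, Theorem 3.1 (iii) with `(m, n) = (d, ℓ)`). [folklore] -/
theorem DiazGridX.two_le_natDiv_iff {d l : ℕ} (hpos : 0 < l + d) :
    2 ≤ d * (l + 1) / (l + d) ↔ d + 2 * l ≤ d * l := by
  rw [Nat.le_div_iff_mul_le hpos]
  have e : d * (l + 1) = d * l + d := by ring
  omega

/-- Conversely, in the range `3(ℓ+d) ≤ d(ℓ+1)` the printed bound is at least `3`, and `d ≥ 4`,
`ℓ ≥ 3` (extreme cases `(d, ℓ) = (4, 8), (5, 5), (6, 4), (9, 3)`). [folklore] -/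
theorem DiazGridX.three_le_natDiv {d l : ℕ} (h3 : 3 * (l + d) ≤ d * (l + 1)) (h : l + d < d * l) :
    3 ≤ d * (l + 1) / (l + d) ∧ 4 ≤ d ∧ 3 ≤ l := by
  obtain ⟨-, hd2, -⟩ := two_le_of_add_lt_mul h
  have hpos : 0 < l + d := by omega
  have e : d * (l + 1) = d * l + d := by ring
  have hb := Diaz1989_thm1.largeRange_bounds (m := d) (n := l) hd2 (by omega)
  exact ⟨(Nat.le_div_iff_mul_le hpos).mpr h3, hb.2, hb.1⟩

/-- Every pair `(d, ℓ)` with `ℓ + d < dℓ` and `d ≤ 3` or `ℓ ≤ 2` lies in the range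
`d(ℓ+1) < 3(ℓ+d)` (`[d(ℓ+1)/(ℓ+d)] ≤ 2`). [folklore] -/
theorem DiazGridX.lt_three_mul_of_le {d l : ℕ} (h : l + d < d * l) (h3 : d ≤ 3 ∨ l ≤ 2) :
    d * (l + 1) < 3 * (l + d) := by
  by_contra hge
  have := DiazGridX.three_le_natDiv (Nat.le_of_not_lt hge) h
  omega

/-! ### From the generated field `ℚ(xᵢ, e^{xᵢyⱼ})` to any `K(x)`, `K ∋ e^{xᵢyⱼ}` -/

/-- Any subfield `K ⊆ ℂ` containing the `e^{xᵢyⱼ}` has `K(x₁, …, x_d) ⊇ ℚ(x_k, e^{y_hx_k})`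
(Diaz's field of Théorème 1 for `v = x`, `u = y`), so
`trdeg_ℚ ℚ(x_k, e^{y_hx_k}) ≤ trdeg_ℚ K(x)` (monotonicity of the transcendence degree,
`DiazMain.trdeg_mono`). This is why Theorem 2.7 may quantify over "a subfield `K` of `ℂ` which
contains the `dℓ` numbers `e^{xᵢyⱼ}`". [folklore] -/
theorem Diaz1989_gridX.trdeg_adjoin_le {d l : ℕ} {x : Fin d → ℂ} {y : Fin l → ℂ}
    {K : IntermediateField ℚ ℂ} (hK : ∀ i j, cexp (x i * y j) ∈ K) :
    Algebra.trdeg ℚ ↥(adjoin ℚ (Set.range x ∪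
        Set.range fun p : Fin l × Fin d => cexp (y p.1 * x p.2))) ≤
      Algebra.trdeg ℚ ↥(adjoin ℚ ((K : Set ℂ) ∪ Set.range x)) := by
  refine DiazMain.trdeg_mono (adjoin_le_iff.mpr ?_)
  rintro z (⟨i, rfl⟩ | ⟨p, rfl⟩)
  · exact subset_adjoin ℚ _ (Set.mem_union_right _ ⟨i, rfl⟩)
  · refine subset_adjoin ℚ _ (Set.mem_union_left _ ?_)
    show cexp (y p.1 * x p.2) ∈ (K : Set ℂ)
    rw [mul_comm]
    exact hK p.2 p.1

/-- The same inclusion for the field `K₃ = ℚ(xᵢ, e^{xᵢyⱼ})` of Ch. 13, Theorem 3.1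
(`gridField₁ x y`): `trdeg_ℚ K₃ ≤ trdeg_ℚ K(x)` for any `K ∋ e^{xᵢyⱼ}`. [folklore] -/
theorem Diaz1989_gridX.trdeg_gridField₁_le {d l : ℕ} {x : Fin d → ℂ} {y : Fin l → ℂ}
    {K : IntermediateField ℚ ℂ} (hK : ∀ i j, cexp (x i * y j) ∈ K) :
    Algebra.trdeg ℚ ↥(gridField₁ x y) ≤
      Algebra.trdeg ℚ ↥(adjoin ℚ ((K : Set ℂ) ∪ Set.range x)) := by
  refine DiazMain.trdeg_mono (adjoin_le_iff.mpr ?_)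
  rintro z (⟨i, rfl⟩ | ⟨p, rfl⟩)
  · exact subset_adjoin ℚ _ (Set.mem_union_right _ ⟨i, rfl⟩)
  · exact subset_adjoin ℚ _ (Set.mem_union_left _ (hK p.1 p.2))

/-! ### `t₁ ≥ 1` and `t₁ ≥ 2` without the Technical Hypothesis -/

/-- **`t₁ ≥ 1` on the whole range of Theorem 2.7, with no Technical Hypothesis**: if `x₁, …, x_d`
and `y₁, …, y_ℓ` are each `ℚ`-linearly independent and `dℓ > ℓ + d` (so `d ≥ 2`, `ℓ ≥ 1`), then
every subfield `K ⊆ ℂ` containing the `e^{xᵢyⱼ}` has `trdeg_ℚ K(x₁, …, x_d) ≥ 1` — the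
Gelfond–Schneider theorem (`DiazMain.one_le_trdeg_adjoin`: `x₂/x₁ ∉ ℚ`, `e^{x₁y₁}`, `e^{x₂y₁}`
cannot all be algebraic together with `x₁, x₂`).
[cite: Laurent1991, §3.1, p. 212 (t₂ ≥ 1 ⟺ Gelfond–Schneider)]
[cite: NesterenkoPhilippon2001, Ch. 14 Thm 2.7 (t₁), p. 248 (case [d(ℓ+1)/(ℓ+d)] = 1)] -/
theorem Diaz1989_gridX.one_le_trdeg {d l : ℕ} (x : Fin d → ℂ) (y : Fin l → ℂ)
    (hx : LinearIndependent ℚ x) (hy : LinearIndependent ℚ y) (h : l + d < d * l)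
    (K : IntermediateField ℚ ℂ) (hK : ∀ i j, cexp (x i * y j) ∈ K) :
    (1 : Cardinal) ≤ Algebra.trdeg ℚ ↥(adjoin ℚ ((K : Set ℂ) ∪ Set.range x)) := by
  obtain ⟨-, hd2, hl1⟩ := two_le_of_add_lt_mul h
  exact (DiazMain.one_le_trdeg_adjoin d l x y hx hy hd2 hl1).trans
    (Diaz1989_gridX.trdeg_gridField₁_le hK)

/-- **`t₁ ≥ 2` for `dℓ ≥ d + 2ℓ`, with no Technical Hypothesis**: if `x₁, …, x_d` and
`y₁, …, y_ℓ` are each `ℚ`-linearly independent, `d, ℓ ≥ 1` and `dℓ ≥ d + 2ℓ`, then every subfield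
`K ⊆ ℂ` containing the `e^{xᵢyⱼ}` has `trdeg_ℚ K(x₁, …, x_d) ≥ 2`. This is LNM 1752, Ch. 14,
Theorem 2.9, clause `t₁` ("`dℓ ≥ d + 2ℓ ⇒ t₁ ≥ 2`"), i.e. Ch. 13, Theorem 3.1 (iii)
(`mn ≥ m + 2n ⇒ trdeg ℚ(xᵢ, e^{xᵢyⱼ}) ≥ 2`), PROVED in the tree (`Laurent2001_thm_3_1_iii_holds`),
transported from `K₃ = ℚ(xᵢ, e^{xᵢyⱼ})` to `K(x) ⊇ K₃`.
[cite: NesterenkoPhilippon2001, Ch. 13 Thm 3.1 (iii), p. 233; Ch. 14 Thm 2.9 (t₁), p. 249] -/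
theorem Diaz1989_gridX.two_le_trdeg {d l : ℕ} (x : Fin d → ℂ) (y : Fin l → ℂ)
    (hx : LinearIndependent ℚ x) (hy : LinearIndependent ℚ y) (hd : 1 ≤ d) (hl : 1 ≤ l)
    (h2 : d + 2 * l ≤ d * l) (K : IntermediateField ℚ ℂ) (hK : ∀ i j, cexp (x i * y j) ∈ K) :
    (2 : Cardinal) ≤ Algebra.trdeg ℚ ↥(adjoin ℚ ((K : Set ℂ) ∪ Set.range x)) :=
  (Laurent2001_thm_3_1_iii_holds d l x y hd hl hx hy h2).trans
    (Diaz1989_gridX.trdeg_gridField₁_le hK)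

/-! ### The conclusion of Theorem 2.7 (t₁) in the range `[d(ℓ+1)/(ℓ+d)] ≤ 2`, unconditionally -/

/-- **`Diaz1989_gridX` in the range `d(ℓ+1) < 3(ℓ+d)`, PROVED, for all `ℚ`-linearly independent
families and with no Technical Hypothesis.** There `[d(ℓ+1)/(ℓ+d)] ≤ 2`: the value `1`
(`d(ℓ+1) < 2(ℓ+d)`) is the Gelfond–Schneider theorem and the value `2`
(`2(ℓ+d) ≤ d(ℓ+1) < 3(ℓ+d)`, i.e. `dℓ ≥ d + 2ℓ`) is LNM 1752 Ch. 13 Thm 3.1 (ii)/(iii) — both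
proved in the tree and combined in `Diaz1989_thm1_midRange` (Diaz's Théorème 1 with
`(n, m, u, v) = (ℓ, d, y, x)`, whose field `ℚ(v_k, e^{u_hv_k})` is `ℚ(x_k, e^{y_hx_k})`;
Laurent 1991, Remarque 3: no measure of linear independence is needed in transcendence degree
`≤ 2`); the bound passes to any `K(x)`, `K ∋ e^{xᵢyⱼ}`, by `Diaz1989_gridX.trdeg_adjoin_le`, and
`[(dℓ+d)/(d+ℓ)] = [d(ℓ+1)/(ℓ+d)]`.
[cite: NesterenkoPhilippon2001, Ch. 14 Thm 2.7 (t₁) + Remark, p. 248 (range [d(ℓ+1)/(ℓ+d)] ≤ 2)]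
[cite: Diaz1989, Théorème 1, pp. 1–2] [cite: Laurent1991, §3.1 Remarque 3, p. 214] -/
theorem Diaz1989_gridX_midRange (d l : ℕ) (x : Fin d → ℂ) (y : Fin l → ℂ)
    (hx : LinearIndependent ℚ x) (hy : LinearIndependent ℚ y) (h : l + d < d * l)
    (hmid : d * (l + 1) < 3 * (l + d)) (K : IntermediateField ℚ ℂ)
    (hK : ∀ i j, cexp (x i * y j) ∈ K) :
    ((d * (l + 1) / (l + d) : ℕ) : Cardinal) ≤
      Algebra.trdeg ℚ ↥(adjoin ℚ ((K : Set ℂ) ∪ Set.range x)) := by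
  obtain ⟨-, hd2, hl1⟩ := two_le_of_add_lt_mul h
  have e1 : d * l + d = d * (l + 1) := by ring
  have hmain := Diaz1989_thm1_midRange l d y x hy hx hl1 hd2 (by omega)
  rw [e1, Nat.add_comm d l] at hmain
  exact hmain.trans (Diaz1989_gridX.trdeg_adjoin_le hK)

/-- **`Diaz1989_gridX` whenever `d ≤ 3` or `ℓ ≤ 2`, PROVED** (no Technical Hypothesis): these
pairs lie in the range `d(ℓ+1) < 3(ℓ+d)` of `Diaz1989_gridX_midRange`
(`DiazGridX.lt_three_mul_of_le`).
[cite: NesterenkoPhilippon2001, Ch. 14 Thm 2.7 (t₁) + Remark, p. 248 (case d ≤ 3 or ℓ ≤ 2)] -/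
theorem Diaz1989_gridX_of_d_le_three_or_l_le_two (d l : ℕ) (x : Fin d → ℂ) (y : Fin l → ℂ)
    (hx : LinearIndependent ℚ x) (hy : LinearIndependent ℚ y) (h : l + d < d * l)
    (h3 : d ≤ 3 ∨ l ≤ 2) (K : IntermediateField ℚ ℂ) (hK : ∀ i j, cexp (x i * y j) ∈ K) :
    ((d * (l + 1) / (l + d) : ℕ) : Cardinal) ≤
      Algebra.trdeg ℚ ↥(adjoin ℚ ((K : Set ℂ) ∪ Set.range x)) :=
  Diaz1989_gridX_midRange d l x y hx hy h (DiazGridX.lt_three_mul_of_le h h3) K hK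

/-! ### What is left: the range `3(ℓ+d) ≤ d(ℓ+1)` -/

/-- **Reduction of `Diaz1989_gridX` to its large range.** Since the range `d(ℓ+1) < 3(ℓ+d)` is
settled unconditionally (`Diaz1989_gridX_midRange`), the named fact follows from its restriction
to `3(ℓ+d) ≤ d(ℓ+1)` — where `[d(ℓ+1)/(ℓ+d)] ≥ 3`, `d ≥ 4`, `ℓ ≥ 3`
(`DiazGridX.three_le_natDiv`), and Diaz's method (Philippon's criterion for algebraic independence
with his zero estimate) is needed; cf. `Diaz1989_gridX_of_mainCriterion`
(`DiazZeroLemmaHolds.lean`) for the whole fact conditionally on the criterion.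
[cite: NesterenkoPhilippon2001, Ch. 14 Thm 2.7 (t₁) + Remark, p. 248]
[cite: Diaz1989, Théorème 1, pp. 1–2] -/
theorem Diaz1989_gridX_of_largeRange
    (H : ∀ (d l : ℕ) (x : Fin d → ℂ) (y : Fin l → ℂ),
      LinearIndependent ℚ x → TechnicalHypothesis x →
      LinearIndependent ℚ y → TechnicalHypothesis y → 3 * (l + d) ≤ d * (l + 1) →
      ∀ K : IntermediateField ℚ ℂ, (∀ i j, cexp (x i * y j) ∈ K) →
        ((d * (l + 1) / (l + d) : ℕ) : Cardinal) ≤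
          Algebra.trdeg ℚ ↥(adjoin ℚ ((K : Set ℂ) ∪ Set.range x))) :
    Diaz1989_gridX := by
  intro d l x y hx hxT hy hyT h K hK
  rcases Nat.lt_or_ge (d * (l + 1)) (3 * (l + d)) with hmid | hlarge
  · exact Diaz1989_gridX_midRange d l x y hx hy h hmid K hK
  · exact H d l x y hx hxT hy hyT hlarge K hK

/-- **`Diaz1989_gridX` is equivalent to its restriction to the range `3(ℓ+d) ≤ d(ℓ+1)`** (with
the standing hypothesis `ℓ + d < dℓ` kept; the rest being proved, `Diaz1989_gridX_midRange`).
[cite: NesterenkoPhilippon2001, Ch. 14 Thm 2.7 (t₁) + Remark, p. 248] -/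
theorem Diaz1989_gridX_iff_largeRange :
    Diaz1989_gridX ↔
      ∀ (d l : ℕ) (x : Fin d → ℂ) (y : Fin l → ℂ),
        LinearIndependent ℚ x → TechnicalHypothesis x →
        LinearIndependent ℚ y → TechnicalHypothesis y → l + d < d * l →
        3 * (l + d) ≤ d * (l + 1) →
        ∀ K : IntermediateField ℚ ℂ, (∀ i j, cexp (x i * y j) ∈ K) →
          ((d * (l + 1) / (l + d) : ℕ) : Cardinal) ≤
            Algebra.trdeg ℚ ↥(adjoin ℚ ((K : Set ℂ) ∪ Set.range x)) := by
  refine ⟨fun hX d l x y hx hxT hy hyT h _ K hK => hX d l x y hx hxT hy hyT h K hK, fun H => ?_⟩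
  intro d l x y hx hxT hy hyT h K hK
  rcases Nat.lt_or_ge (d * (l + 1)) (3 * (l + d)) with hmid | hlarge
  · exact Diaz1989_gridX_midRange d l x y hx hy h hmid K hK
  · exact H d l x y hx hxT hy hyT h hlarge K hK

/-- **`Diaz1989_gridX` from Diaz's Théorème 1 restricted to ITS large range `3(m+n) ≤ mn + m`**
(`[(mn+m)/(m+n)] ≥ 3`; the rest of Théorème 1 is proved, `Diaz1989_thm1_of_range_three_le`):
composed with `Diaz1989_gridX_of_thm1` ((T.H.) ⇒ (HT1), `DiazMain.lean`).
[cite: Diaz1989, Théorème 1, pp. 1–2]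
[cite: NesterenkoPhilippon2001, Ch. 14 Thm 2.7 (t₁), p. 248] -/
theorem Diaz1989_gridX_of_thm1_largeRange
    (H : ∀ (n m : ℕ) (u : Fin n → ℂ) (v : Fin m → ℂ),
      LinearIndependent ℚ u → LinearIndependent ℚ v →
      Diaz1989.MeasureA u ((m * (n + 1) : ℝ) / (2 * m + n)) →
      Diaz1989.MeasureB v ((m * (n + 1) : ℝ) / (m + 2 * n + 1)) →
      1 ≤ n → 2 ≤ m → 3 * (m + n) ≤ m * n + m →
        (((m * n + m) / (m + n) : ℕ) : Cardinal) ≤ Algebra.trdeg ℚ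
          ↥(adjoin ℚ (Set.range v ∪
            Set.range fun p : Fin n × Fin m => cexp (u p.1 * v p.2)))) :
    Diaz1989_gridX :=
  Diaz1989_gridX_of_thm1 (Diaz1989_thm1_of_range_three_le H)

/-! ### The remaining trust base: three facts of LNM 1752 Ch. 3 §4 -/

/-- **`Diaz1989_gridX` from the core of Nesterenko's elimination-theoretic toolkit** — LNM 1752
Ch. 3 §4, Prop. 4.4 (the associated form), Prop. 4.11 (the Bézout inequality) and Prop. 4.13 (a
close zero), the three named facts to which the tree reduces Philippon's criterion for algebraic
independence (`Philippon1986_mainCriterion_of_nesterenko'`, `PhilipponCriterionMain.lean`, with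
Prop. 4.7 supplied by `NesterenkoPhilippon2001_ch3_prop_4_7_of_prop_4_4`, Cor. 4.12 by
`NesterenkoPhilippon2001_ch3_cor_4_12_of_prop_4_11`, and Cor. 4.10 discharged), then Diaz's method
with the PROVED zero estimate (`Diaz1989_gridX_of_mainCriterion`, `DiazZeroLemmaHolds.lean`; the
same composite as `Diaz1989_thm1_of_nesterenko'` of `DiazCor1Proofs.lean` for Théorème 1). This is
the current trust base of the fact; its discharge is this theorem applied to the discharges of the
three facts.
[cite: NesterenkoPhilippon2001, Ch. 14 Thm 2.7 (t₁), p. 248; Ch. 3 §4 Prop. 4.4, 4.11, 4.13]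
[cite: Diaz1989, Théorème 1, pp. 1–2] -/
theorem Diaz1989_gridX_of_nesterenko (h44 : NesterenkoPhilippon2001_ch3_prop_4_4)
    (h411 : NesterenkoPhilippon2001_ch3_prop_4_11) (h413 : NesterenkoPhilippon2001_ch3_prop_4_13) :
    Diaz1989_gridX :=
  Diaz1989_gridX_of_mainCriterion
    (Philippon1986_mainCriterion_of_nesterenko' h44
      (NesterenkoPhilippon2001_ch3_prop_4_7_of_prop_4_4 h44) h411
      (NesterenkoPhilippon2001_ch3_cor_4_12_of_prop_4_11 h411) h413)

/-! ### One fact left: LNM 1752 Ch. 3 Prop. 4.11 -/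

/-- **`Diaz1989_gridX` from LNM 1752 Ch. 3 Prop. 4.11 alone** — the whole remaining trust base of
the fact: `Diaz1989_gridX_of_nesterenko` with Prop. 4.4 supplied by its discharge
`NesterenkoPhilippon2001_ch3_prop_4_4_holds` (`NesterenkoEliminationProp44Holds.lean`) and
Prop. 4.13 by `NesterenkoPhilippon2001_ch3_prop_4_13_of_prop_4_4`
(`NesterenkoEliminationProp413Proofs.lean`); everything else on the road LNM 1752 Ch. 14
Thm 2.7 (t₁) ⇐ Diaz's Théorème 1 ⇐ Philippon's criterion + Diaz's zero lemma ⇐ Ch. 3 §4 being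
proved in the tree, granted the metric Bézout step Prop. 4.11 (the same one-fact form as
`Diaz1989_thm1_of_prop_4_11`, `DiazCor1Proofs.lean`, and `Diaz1989_gridXY_of_prop_4_11`,
`DiazGridXYOfCriterion.lean`).
[cite: NesterenkoPhilippon2001, Ch. 14 Thm 2.7 (t₁), p. 248; Ch. 3 §4 Prop. 4.11 (pp. 40–41)]
[cite: Diaz1989, Théorème 1, pp. 1–2] -/
theorem Diaz1989_gridX_of_prop_4_11 (h411 : NesterenkoPhilippon2001_ch3_prop_4_11) :
    Diaz1989_gridX :=
  Diaz1989_gridX_of_nesterenko NesterenkoPhilippon2001_ch3_prop_4_4_holds h411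
    (NesterenkoPhilippon2001_ch3_prop_4_13_of_prop_4_4 NesterenkoPhilippon2001_ch3_prop_4_4_holds)

end Literature.NumberTheory.Transcendental

end
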